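import Summits.CriticalPhenomena.PercolationContinuityZ3.Theorems.PercNearOneGluingNoHeavyQuantChemicalSphereWindow
import Mathlib.MeasureTheory.Integral.Bochner.Set
import HarnessLib

/-!
# THE CRITICAL CHEMICAL SPHERES ARE EVENTUALLY EMPTY ALMOST SURELY, EMPTY WITH PROBABILITY `→ 1`, YET OF EXPECTED SIZE `≥ 1`:
# THEIR MASS ESCAPES TO INFINITY — `Σ_x P_{p_c}(x ∈ ∂B_int(0,k), |∂B_int(0,k)| > M) ≥ 1 − M·P_{p_c}(Rad_int ≥ k) → 1`
# for every `M` (p205010 reading), `≥ 1 − MC/k` in high dimensions — quant lane, seat p4 gen 39, file 5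

builds on p205010 (kernel theorem, internal audit signed; external expert review pending) — USED in §3
(`ChemSphere.ae_eventually_level_eq_empty`, `ChemSphere.eventually_le_sumLevelBig_criticalProbI`, through
`CSH.percolationContinuity_allDimensions` / gen 38's `ChemRad.tendsto_real_far_criticalProbI`); §1–§2 and the high-dimensional
rate are p205010-free.
Seat `prim-quant-p4`, `--supports stmt-CriticalPhenomena-4575`; pure proofs, no definitions (`local notation3` only).

Notation: `N_k = |∂B_int(0,k)|` (`level (zdGraph d) 0 k ω`, a subset of `Λ_k`), `L_p(k) = E_p N_k = Σ_{x∈Λ_k} P_p(x ∈ ∂B_int(0,k))`,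
`L_p^{>M}(k) = Σ_{x∈Λ_k} P_p(x ∈ ∂B_int(0,k), N_k > M) = E_p[N_k; N_k > M]`, `F_p(k) = P_p(Rad_int ≥ k) = P_p(N_k ≥ 1)`.

* §1 `ChemSphere.determinedBy_ncard_level_le`, **`ChemSphere.sum_real_level_inter_small_le`** — `E_p[N_k; N_k ≤ M] ≤ M·P_p(N_k ≥ 1)`
  (as finite sums of probabilities: `Σ_x P_p(x ∈ ∂B_int(0,k), N_k ≤ M) ≤ M·F_p(k)`; pointwise `Σ_x 1 = N_k ≤ M` on the event, and
  `N_k ≥ 1` there unless the sum vanishes).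
* §2 **`ChemSphere.sumLevel_sub_le_sumLevelBig`** — `L_p(k) − M·F_p(k) ≤ L_p^{>M}(k)` (every `p`, `k`, `M`).
* §3 at `p_c` (`d ≥ 2`): **`ChemSphere.one_sub_le_sumLevelBig_criticalProbI`** — `L_{p_c}^{>M}(k) ≥ 1 − M·F_{p_c}(k)` (file 2's
  `L_{p_c}(k) ≥ 1`); **`ChemSphere.eventually_le_sumLevelBig_criticalProbI`** — for every `M` and `ε > 0`, eventually in `k`,
  `E_{p_c}[N_k; N_k > M] ≥ 1 − ε` (p205010: `F_{p_c}(k) → 0`); **`ChemSphere.ae_eventually_level_eq_empty`** — `P_{p_c}`-a.s. the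
  spheres `∂B_int(0,k)` are EMPTY for all large `k` (`θ(p_c) = 0`); and **`ChemSphere.sumLevelBig_criticalProbI_ge_of_triangle`**,
  **`…_high_dim`** — `E_{p_c}[N_k; N_k > M] ≥ 1 − M·C/k` for `k ≥ 1` under the triangle condition / for `d ≥ D` (gen 38's
  `F_{p_c}(k) ≤ C/k`).  So at criticality `N_k → 0` almost surely and in probability, `E N_k ≥ 1` for every `k`, and for every `M`
  the unit of expected mass is eventually carried by spheres with more than `M` sites: `(N_k)` is not uniformly integrable — the
  incipient-infinite-cluster picture (rare survival, large surviving generations) in every dimension, hypothesis-free except for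
  `θ(p_c) = 0`.

HONEST STATUS.  NEW AS TYPED, elementary on files 1–3; the qualitative statements of §3 are READINGS of p205010, the high-dimensional
rate is unconditional.  NO rate, NO exponent for `d = 3`; (T1)/(T2) and the lane's honest sentence UNCHANGED.

References: G. Kozma, A. Nachmias, Invent. Math. 178 (2009) Thm 1.2(ii), 1.3 [KozmaNachmias2009]; M. Heydenreich, R. van der
Hofstad (2017) §15.3 (IIC) [HeydenreichVanDerHofstad2017]; T. Hutchcroft, PLMS 125 (2022) Prop 4.2 [Hutchcroft2022SlightlySupercritical].
-/

noncomputable section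

namespace Summit.CriticalPhenomena.PercolationContinuityZ3.Theorems

open MeasureTheory Set Filter Topology Literature.Probability.Percolation Literature.Probability.LatticeModels
open Literature.Probability.Percolation.Chemical Literature.Probability.Percolation.DCT16
open scoped Classical

namespace ChemSphere

variable {d : ℕ}

/-- `L_p(k) = Σ_{x ∈ Λ_k} P_p(x ∈ ∂B_int(0,k)) = E_p|∂B_int(0,k)|`. -/
local notation3 "SL[" p ", " k "]" =>
  ∑ x ∈ box d k, (bondPercolation (zdGraph d) p).real {ω : BondConfig (Site d) | x ∈ level (zdGraph d) 0 k ω}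

/-- `L_p^{>M}(k) = Σ_{x ∈ Λ_k} P_p(x ∈ ∂B_int(0,k), |∂B_int(0,k)| > M) = E_p[N_k; N_k > M]`. -/
local notation3 "SLBIG[" p ", " k ", " M "]" =>
  ∑ x ∈ box d k, (bondPercolation (zdGraph d) p).real
    ({ω : BondConfig (Site d) | x ∈ level (zdGraph d) 0 k ω} ∩ {ω | M < (level (zdGraph d) 0 k ω).ncard})

/-- `F_p(k) = P_p(Rad_int(C(0)) ≥ k) = P_p(∂B_int(0,k) ≠ ∅)`. -/
local notation3 "FAR[" p ", " k "]" => (bondPercolation (zdGraph d) p).real (far (zdGraph d) (0 : Site d) k)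

/-! ### §1. `E_p[N_k; N_k ≤ M] ≤ M · P_p(N_k ≥ 1)` -/

/-- `{|∂B_int(0,k)| ≤ M}` is determined by the lattice edges touching `Λ_k`. [folklore] -/
theorem determinedBy_ncard_level_le (k M : ℕ) :
    DeterminedBy {ω : BondConfig (Site d) | (level (zdGraph d) 0 k ω).ncard ≤ M}
      (↑(edgesTouching (zdGraph d) (box d k)) : Set (Sym2 (Site d))) := by
  rw [determinedBy_iff]
  intro ω ω' h
  simp only [Set.mem_setOf_eq]
  rw [level_eq_of_agree (agree_of_inter_eq h) (i := k) (by omega)]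

/-- `{|∂B_int(0,k)| > M}` is determined by the lattice edges touching `Λ_k`. [folklore] -/
theorem determinedBy_lt_ncard_level (k M : ℕ) :
    DeterminedBy {ω : BondConfig (Site d) | M < (level (zdGraph d) 0 k ω).ncard}
      (↑(edgesTouching (zdGraph d) (box d k)) : Set (Sym2 (Site d))) := by
  rw [determinedBy_iff]
  intro ω ω' h
  simp only [Set.mem_setOf_eq]
  rw [level_eq_of_agree (agree_of_inter_eq h) (i := k) (by omega)]

/-- The level is a finite set. [folklore] -/
theorem level_finite (k : ℕ) (ω : BondConfig (Site d)) : (level (zdGraph d) 0 k ω).Finite :=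
  (box d k).finite_toSet.subset (level_subset_box k ω)

/-- Pointwise count: `Σ_{x ∈ Λ_k} 1{x ∈ ∂B_int(0,k)} = |∂B_int(0,k)|`. [folklore] -/
theorem sum_indicator_mem_level (k : ℕ) (ω : BondConfig (Site d)) :
    ∑ x ∈ box d k, ({ω : BondConfig (Site d) | x ∈ level (zdGraph d) 0 k ω}).indicator (fun _ => (1 : ℝ)) ω =
      ((level (zdGraph d) 0 k ω).ncard : ℝ) := by
  have hsub : (level_finite k ω).toFinset ⊆ box d k := by
    intro x hx
    rw [Set.Finite.mem_toFinset] at hx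
    exact level_subset_box k ω hx
  rw [Set.ncard_eq_toFinset_card _ (level_finite k ω), ← Finset.sum_subset hsub (fun x _ hx => by
    rw [Set.Finite.mem_toFinset] at hx
    simp [Set.indicator_of_notMem (show ω ∉ {ω' : BondConfig (Site d) | x ∈ level (zdGraph d) 0 k ω'} from hx)])]
  rw [Finset.card_eq_sum_ones, Nat.cast_sum]
  refine Finset.sum_congr rfl fun x hx => ?_
  rw [Set.Finite.mem_toFinset] at hx
  simp [Set.indicator_of_mem (show ω ∈ {ω' : BondConfig (Site d) | x ∈ level (zdGraph d) 0 k ω'} from hx)]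

/-- **`E_p[N_k; N_k ≤ M] ≤ M · P_p(N_k ≥ 1)`**: `Σ_{x∈Λ_k} P_p(x ∈ ∂B_int(0,k), |∂B_int(0,k)| ≤ M) ≤ M · P_p(Rad_int ≥ k)` (pointwise
the sum of the indicators is `|∂B_int(0,k)| ≤ M`, and vanishes unless `∂B_int(0,k) ≠ ∅`). [folklore] -/
theorem sum_real_level_inter_small_le (p : unitInterval) (k M : ℕ) :
    ∑ x ∈ box d k, (bondPercolation (zdGraph d) p).real
        ({ω : BondConfig (Site d) | x ∈ level (zdGraph d) 0 k ω} ∩ {ω | (level (zdGraph d) 0 k ω).ncard ≤ M}) ≤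
      M * FAR[p, k] := by
  set μ := bondPercolation (zdGraph d) p with hμ
  set B : Set (BondConfig (Site d)) := {ω | (level (zdGraph d) 0 k ω).ncard ≤ M} with hB
  have hBm : MeasurableSet B := (determinedBy_ncard_level_le (d := d) k M).measurableSet_of_finset
  have hAm : ∀ x, MeasurableSet ({ω : BondConfig (Site d) | x ∈ level (zdGraph d) 0 k ω} ∩ B) :=
    fun x => (measurableSet_mem_level x k).inter hBm
  have hFm : MeasurableSet (far (zdGraph d) (0 : Site d) k) := measurableSet_far (zdGraph d) 0 k
  -- as integrals of indicators
  have hlhs : ∑ x ∈ box d k, μ.real ({ω : BondConfig (Site d) | x ∈ level (zdGraph d) 0 k ω} ∩ B) =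
      ∫ ω, ∑ x ∈ box d k, ({ω : BondConfig (Site d) | x ∈ level (zdGraph d) 0 k ω} ∩ B).indicator (fun _ => (1 : ℝ)) ω ∂μ := by
    rw [integral_finsetSum _ fun x _ => (integrable_const (1 : ℝ)).indicator (hAm x)]
    exact Finset.sum_congr rfl fun x _ => (integral_indicator_one (hAm x)).symm
  have hrhs : (M : ℝ) * μ.real (far (zdGraph d) (0 : Site d) k) =
      ∫ ω, (M : ℝ) * (far (zdGraph d) (0 : Site d) k).indicator (fun _ => (1 : ℝ)) ω ∂μ := by
    rw [integral_const_mul]; congr 1; exact (integral_indicator_one hFm).symm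
  rw [hlhs, hrhs]
  refine integral_mono (integrable_finsetSum _ fun x _ => (integrable_const (1 : ℝ)).indicator (hAm x))
    (((integrable_const (1 : ℝ)).indicator hFm).const_mul _) fun ω => ?_
  -- pointwise: `Σ_x 1_{x ∈ L, |L| ≤ M} ≤ M · 1_{L ≠ ∅}`
  dsimp only
  by_cases hω : ω ∈ B
  · have heq : ∑ x ∈ box d k, ({ω : BondConfig (Site d) | x ∈ level (zdGraph d) 0 k ω} ∩ B).indicator (fun _ => (1 : ℝ)) ω =
        ((level (zdGraph d) 0 k ω).ncard : ℝ) := by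
      rw [← sum_indicator_mem_level k ω]
      refine Finset.sum_congr rfl fun x _ => ?_
      by_cases hx : ω ∈ {ω' : BondConfig (Site d) | x ∈ level (zdGraph d) 0 k ω'}
      · rw [Set.indicator_of_mem (Set.mem_inter hx hω), Set.indicator_of_mem hx]
      · rw [Set.indicator_of_notMem (fun h => hx h.1), Set.indicator_of_notMem hx]
    rw [heq]
    rcases Nat.eq_zero_or_pos (level (zdGraph d) 0 k ω).ncard with h0 | hpos
    · rw [h0, Nat.cast_zero]
      exact mul_nonneg (Nat.cast_nonneg M) (Set.indicator_nonneg (fun _ _ => zero_le_one) _)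
    · obtain ⟨z, hz⟩ := (Set.ncard_pos (level_finite k ω)).1 hpos
      rw [Set.indicator_of_mem (mem_far_of_mem_level hz le_rfl), mul_one]
      exact_mod_cast (show (level (zdGraph d) 0 k ω).ncard ≤ M from hω)
  · have hzero : ∑ x ∈ box d k, ({ω : BondConfig (Site d) | x ∈ level (zdGraph d) 0 k ω} ∩ B).indicator (fun _ => (1 : ℝ)) ω = 0 :=
      Finset.sum_eq_zero fun x _ => Set.indicator_of_notMem (fun h => hω h.2) _
    rw [hzero]
    exact mul_nonneg (Nat.cast_nonneg M) (Set.indicator_nonneg (fun _ _ => zero_le_one) _)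

/-! ### §2. `E_p[N_k; N_k > M] ≥ E_p N_k − M·P_p(N_k ≥ 1)` -/

/-- **`L_p(k) − M·P_p(Rad_int ≥ k) ≤ E_p[N_k; N_k > M]`** (split each term along `{N_k ≤ M} ⊔ {N_k > M}` and apply §1). [folklore] -/
theorem sumLevel_sub_le_sumLevelBig (p : unitInterval) (k M : ℕ) : SL[p, k] - M * FAR[p, k] ≤ SLBIG[p, k, M] := by
  set μ := bondPercolation (zdGraph d) p with hμ
  have hsplit : ∀ x, μ.real {ω : BondConfig (Site d) | x ∈ level (zdGraph d) 0 k ω} =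
      μ.real ({ω : BondConfig (Site d) | x ∈ level (zdGraph d) 0 k ω} ∩ {ω | (level (zdGraph d) 0 k ω).ncard ≤ M}) +
        μ.real ({ω : BondConfig (Site d) | x ∈ level (zdGraph d) 0 k ω} ∩ {ω | M < (level (zdGraph d) 0 k ω).ncard}) := by
    intro x
    rw [← measureReal_union]
    · congr 1
      ext ω
      simp only [Set.mem_setOf_eq, Set.mem_union, Set.mem_inter_iff]
      constructor
      · intro h; by_cases hM : (level (zdGraph d) 0 k ω).ncard ≤ M
        · exact Or.inl ⟨h, hM⟩
        · exact Or.inr ⟨h, not_le.1 hM⟩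
      · rintro (⟨h, -⟩ | ⟨h, -⟩) <;> exact h
    · exact Set.disjoint_left.2 fun ω h1 h2 =>
        (not_le.2 (show M < (level (zdGraph d) 0 k ω).ncard from h2.2)) (show (level (zdGraph d) 0 k ω).ncard ≤ M from h1.2)
    · exact (measurableSet_mem_level x k).inter (determinedBy_lt_ncard_level (d := d) k M).measurableSet_of_finset
  have hsum : SL[p, k] = (∑ x ∈ box d k, μ.real ({ω : BondConfig (Site d) | x ∈ level (zdGraph d) 0 k ω} ∩
      {ω | (level (zdGraph d) 0 k ω).ncard ≤ M})) + SLBIG[p, k, M] := by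
    rw [← Finset.sum_add_distrib]
    exact Finset.sum_congr rfl fun x _ => hsplit x
  have h := sum_real_level_inter_small_le (d := d) p k M
  linarith

/-! ### §3. At criticality: a.s. eventually empty, yet the expected mass `≥ 1` escapes to large spheres -/

/-- **`E_{p_c}[N_k; N_k > M] ≥ 1 − M·P_{p_c}(Rad_int ≥ k)`** for every `k`, `M` (`d ≥ 2`): file 2's `E_{p_c}N_k ≥ 1` and §2.
p205010-free. [cite: KozmaNachmias2009, Thm. 1.3] -/
theorem one_sub_le_sumLevelBig_criticalProbI (hd : 2 ≤ d) (k M : ℕ) :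
    1 - M * FAR[criticalProbI d, k] ≤ SLBIG[criticalProbI d, k, M] :=
  le_trans (by linarith [one_le_sumLevel_criticalProbI hd k]) (sumLevel_sub_le_sumLevelBig (criticalProbI d) k M)

/-- **p205010 READING — THE MASS OF THE CRITICAL CHEMICAL SPHERES ESCAPES TO INFINITY: for every `M` and every `ε > 0`, for all
large `k`, `E_{p_c}[N_k; N_k > M] ≥ 1 − ε`** (every `d ≥ 2`; `P_{p_c}(Rad_int ≥ k) → 0` by `θ(p_c) = 0`).  The expected sphere
size is `≥ 1` at every radius, yet essentially all of it sits on spheres with more than `M` sites: `(N_k)_k` is not uniformly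
integrable under `P_{p_c}`.  builds on p205010 (kernel theorem, internal audit signed; external expert review pending).
[cite: KozmaNachmias2009, Thm. 1.3] [cite: HeydenreichVanDerHofstad2017, §15.3] -/
theorem eventually_le_sumLevelBig_criticalProbI (hd : 2 ≤ d) (M : ℕ) {ε : ℝ} (hε : 0 < ε) :
    ∀ᶠ k : ℕ in atTop, 1 - ε ≤ SLBIG[criticalProbI d, k, M] := by
  have hsmall : ∀ᶠ k : ℕ in atTop, (M : ℝ) * FAR[criticalProbI d, k] ≤ ε := by
    have h := (ChemRad.tendsto_real_far_criticalProbI hd).const_mul (M : ℝ)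
    rw [mul_zero] at h
    exact h.eventually (ge_mem_nhds hε)
  filter_upwards [hsmall] with k hk
  linarith [one_sub_le_sumLevelBig_criticalProbI hd k M]

/-- **p205010 READING — THE CRITICAL SPHERES ARE EVENTUALLY EMPTY, ALMOST SURELY**: `P_{p_c}`-a.s., `∂B_int(0,k) = ∅` for all large
`k` (the cluster of the origin is finite since `θ(p_c) = 0`), although `E_{p_c}|∂B_int(0,k)| ≥ 1` for every `k` (file 2).
builds on p205010 (kernel theorem, internal audit signed; external expert review pending). [cite: KozmaNitzan2024, Thm. 6] -/
theorem ae_eventually_level_eq_empty (hd : 2 ≤ d) :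
    ∀ᵐ ω ∂(bondPercolation (zdGraph d) (criticalProbI d)), ∀ᶠ k : ℕ in atTop, level (zdGraph d) (0 : Site d) k ω = ∅ := by
  set μ := bondPercolation (zdGraph d) (criticalProbI d) with hμ
  have hθ : μ.real (percolatesAt (0 : Site d)) = 0 := CSH.percolationContinuity_allDimensions d hd
  have hθ' : μ (percolatesAt (0 : Site d)) = 0 := by
    rwa [measureReal_def, ENNReal.toReal_eq_zero_iff, or_iff_left (measure_ne_top _ _)] at hθ
  have hfar : μ (⋂ r : ℕ, far (zdGraph d) (0 : Site d) r) = 0 := measure_mono_null ChemRad.iInter_far_subset_percolatesAt hθ'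
  filter_upwards [compl_mem_ae_iff.2 hfar] with ω hω
  rw [Set.mem_compl_iff, Set.mem_iInter, not_forall] at hω
  obtain ⟨r, hr⟩ := hω
  filter_upwards [eventually_ge_atTop r] with k hk
  exact Set.eq_empty_of_forall_notMem fun z hz => hr (mem_far_of_mem_level hz hk)

/-- **IN PROBABILITY vs IN MEAN (every `d ≥ 2`)**: `P_{p_c}(∂B_int(0,k) ≠ ∅) → 0` while `E_{p_c}|∂B_int(0,k)| ≥ 1` for every `k`.
builds on p205010 (kernel theorem, internal audit signed; external expert review pending). [cite: KozmaNachmias2009, Thm. 1.3] -/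
theorem sphere_empty_in_probability_not_in_mean (hd : 2 ≤ d) :
    Tendsto (fun k : ℕ => FAR[criticalProbI d, k]) atTop (𝓝 0) ∧ ∀ k : ℕ, 1 ≤ SL[criticalProbI d, k] :=
  ⟨ChemRad.tendsto_real_far_criticalProbI hd, one_le_sumLevel_criticalProbI hd⟩

/-- **HIGH DIMENSIONS (triangle condition): `E_{p_c}[N_k; N_k > M] ≥ 1 − M·C/k`** for all `k ≥ 1`, `M` (gen 38's
`P_{p_c}(Rad_int ≥ k) ≤ C/k`, Kozma–Nachmias Thm 1.2(ii)); p205010-free. [cite: KozmaNachmias2009, Thm. 1.2(ii)] -/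
theorem sumLevelBig_criticalProbI_ge_of_triangle (hd : 2 ≤ d) (hT : TriangleCondition d) :
    ∃ C : ℝ, 0 < C ∧ ∀ k : ℕ, 1 ≤ k → ∀ M : ℕ, 1 - M * C / k ≤ SLBIG[criticalProbI d, k, M] := by
  obtain ⟨C, hC, hup⟩ := ChemRad.real_far_criticalProbI_le_of_triangle hd hT
  refine ⟨C, hC, fun k hk M => le_trans ?_ (one_sub_le_sumLevelBig_criticalProbI hd k M)⟩
  have hk0 : (0 : ℝ) < k := by exact_mod_cast hk
  have h := hup k hk
  rw [Real.rpow_neg hk0.le, Real.rpow_one, ← div_eq_mul_inv] at h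
  have hM : (0 : ℝ) ≤ M := Nat.cast_nonneg M
  have : (M : ℝ) * FAR[criticalProbI d, k] ≤ M * C / k := by
    rw [mul_div_assoc]; exact mul_le_mul_of_nonneg_left h hM
  linarith

/-- **HIGH DIMENSIONS, unconditionally: `∃ D > 6, ∀ d ≥ D, ∃ C > 0, ∀ k ≥ 1, ∀ M, E_{p_c}[N_k; N_k > M] ≥ 1 − M C/k`.**
[cite: KozmaNachmias2009, Thm. 1.2(ii), Thm. 1.3] -/
theorem sumLevelBig_criticalProbI_ge_high_dim :
    ∃ D : ℕ, 6 < D ∧ ∀ d : ℕ, D ≤ d → ∃ C : ℝ, 0 < C ∧ ∀ k : ℕ, 1 ≤ k → ∀ M : ℕ,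
      1 - M * C / k ≤ ∑ x ∈ box d k, (bondPercolation (zdGraph d) (criticalProbI d)).real
        ({ω : BondConfig (Site d) | x ∈ level (zdGraph d) 0 k ω} ∩ {ω | M < (level (zdGraph d) 0 k ω).ncard}) := by
  obtain ⟨D, hD, hT⟩ := Literature.Barriers.CriticalPhenomena.HaraSlade1990_triangleCondition_holds
  exact ⟨D, hD, fun d hdD => sumLevelBig_criticalProbI_ge_of_triangle (by omega) (hT d hdD)⟩

end ChemSphere

end Summit.CriticalPhenomena.PercolationContinuityZ3.Theorems

end
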